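import Summits.AtomisticToContinuum.HydrodynamicLimit.Theses.SpeedCapSurgery
import Summits.AtomisticToContinuum.HydrodynamicLimit.Theorems.TwoClocksEntropyToHydro
import HarnessLib

/-!
# Birth skeleton (BC3) for crux `CappedEulerLimit` — item stmt-AtomisticToContinuum-17739,
# route `SpeedCapSurgery` (rank 3, crux (U)), sub-problem `HydrodynamicLimit`

Crux BY NAME: `Summit.AtomisticToContinuum.HydrodynamicLimit.Theses.SpeedCapSurgery.CappedEulerLimit`
(∃ η₀ > 0 ∀ continuous positive profiles ∃ σ₀ ∀ 0 < σ < σ₀ ∀ classical hs-Euler solutions IN THE PACKING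
BAND `ρ_t σ³ < η₀` ∀ flow families `Φ_N` with the local-Gibbs LLN at `t = 0` ∀ t ∈ [0,T) ∀ C:
`TendstoHydroFieldsAt` at time `t` for the initial local Gibbs laws RESTRICTED to the cap event
`{z | ∀ r ∈ [0,t], ∀ i, |v_i(Φ_N(r) z)| ≤ C√log(N+2)}` — the packing-guarded conjunct with an `L∞` speed cap
granted for free).

THE LINE is the route's own foreseen two-layer plan for (U) ("CappedEulerLimit ⇐ CappedGronwall (Yau's
relative-entropy Gronwall on the cap event with constant ≤ C·√log N …) → …", route file § Two-layer plan):
Yau 1991 / Olla–Varadhan–Yau 1993 §3–5 run for the DETERMINISTIC hard-sphere flow on `𝕋³`, in the band,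
for the CAPPED initial law `λ_N|cap` pushed forward by the flow, against the EXPLICIT local Gibbs
reference built on the Euler solution with the thermodynamic activity `eosActivity σ (ρ t)`
(`= ρ_t · exp(f_ex(ρ_tσ³) + ρ_tσ³ f_ex'(ρ_tσ³))`, definitionally the tree's `thermoActivity`). The cut
has three registered seams and one PROVED seam:

* `stub_reference` — **IN-BAND STATICS OF THE REFERENCE FAMILY (size M)**: `∃ ηs > 0,
  ReferenceStaticsBelow ηs`: for all profiles there is `σ₀` such that for `σ < σ₀` and every classical
  solution with `ρ_t σ³ < ηs` on `[0,T) × 𝕋³`: (i) the initial local Gibbs laws are probability laws;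
  (ii) if their fields converge at `t = 0`, then at every `t ∈ [0,T)` the reference
  `localGibbsLaw σ (eosActivity σ (ρ t)) (u t) (θ t)` is a probability law whose three empirical fields
  concentrate exponentially around `(ρ, ρu, E)(t)` (`RefConcentrates`). Content: mass conservation
  `∫ρ_t = ∫ρ_0 = 1` for the classical solution on `𝕋³` (the `t = 0` LLN with `χ ≡ 1`), and the landed
  dilute statics `thermoActivity_spec` / `thermoActivity_concentration` at each `t` (built on the proved
  items 14445, 0768). Verbatim clauses (i)–(ii) of the sibling birth line of crux 17396
  (`Cruxes/RelEntropyVanishingInBand/Lines/birth.lean`, `ReferenceFamilyBelow`), so one proof serves both.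
* `stub_timeZero` — **THE TIME-ZERO MEMBER OF THE REFERENCE FAMILY IS THE INITIAL LAW (size M)**:
  `TimeZeroIdentity`: for `σ < σ₀(profiles)`, every classical solution with `0 < T`, every flow family:
  the LLN at `t = 0` forces `localGibbsLaw σ (eosActivity σ (ρ 0)) (u 0) (θ 0) N Φ_N = localGibbsLaw σ a₀ u₀
  θ₀ N Φ_N` for EVERY `N` — EXACT equality, no rate lost: `(ρ, u, θ)(0) = (rhoLim a₀, u₀, θ₀)` by
  uniqueness of limits in probability, `a₀ = ζ · eosActivity σ (ρ 0)` by the dilute uniqueness of the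
  activity modulo constants, and the canonical law is invariant under `a ↦ ζ a`. The landed
  `Theorems/TwoClocksClampedEntropyClockTimeZeroReference.stub_timeZeroReference` proves it for the activity
  `ρ_0 · Rf(σ³ρ_0)`, which `thermoActivity_spec` (ii) identifies with `eosActivity σ (ρ 0)` in the band.
  This seam is where THIS line needs exactness: the capped Gronwall multiplies the initial entropy by
  `exp(K·C√log(N+2)·t) = N^{o(1)}`, so a rate-free `o(N)` initial entropy (the sibling lines' clause
  (iii)) would NOT do; with equality the capped initial entropy is `λ_N(capᶜ) ≤ 1`.
* `stub_cappedGronwall` — **THE CAPPED DETERMINISTIC RELATIVE-ENTROPY GRONWALL IN THE BAND (size XL,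
  load-bearing)**: `∃ ηd > 0, CappedEntropyPropagationBelow ηd`: below a packing threshold `ηd` of the
  prover's choosing, for every classical solution in the band and every flow family, PROBABILITY initial
  laws + convergence of the fields at `t = 0` + the time-zero identity + a concentrating probability
  reference family imply, for every `t ∈ [0,T)` and EVERY `C`,
  `H((Φ_N,t)_*(λ_N|cap_{t,C}) ‖ reference_t)/(N+1) → 0`. Inside (the whole dynamics, Yau's clock on the cap
  event): the entropy-production identity for the torus Liouville flow with hard-core CONTACT currents
  restricted to the cap event (the restricted law is still transported by the flow: `cap` is a fixed set
  of initial data), linear terms cancelled by the Euler solution with `p = hsPressure`, the cubic energy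
  current truncated EXACTLY at `M_N = C√log(N+2)` (no Chebyshev error: on the support of the capped law
  every speed is `≤ M_N` at every `r ≤ t`), entropy-inequality pricing of the truncated currents with
  `γ_N = δ/M_N` (Nachtergaele–Yau 2003 §5 Lemma 5.1: the constant is LINEAR in the cut-off), hence a
  differential inequality `H' ≤ K M_N (H + N·ω_N)` and the Gronwall factor `e^{K M_N t} = N^{o(1)}`
  (NY 2003 §7.2), so the ONE-BLOCK replacement error `ω_N` of the capped deterministic dynamics must come
  WITH A RATE `N^{-a}` (the route's recorded price; rate-free closures through OVY limit states do not
  suffice at this cap), bad blocks `{d̄ ≥ φ₀}` / quadratic fluctuations priced by the reference large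
  deviations, virial identification of the Gibbs currents with `hsPressure`; the capped initial entropy is
  `H(λ_N|cap ‖ λ_N) = λ_N(capᶜ) ≤ 1` by `stub_timeZero`.
* (seam, PROVED here) `tendstoHydroFieldsAt_of_klDiv_lawAt` — **THE ENTROPY INEQUALITY FOR THE CAPPED
  LAWS**: for ANY family of finite initial laws `P_N` (here `P_N = λ_N|cap`), `H((Φ_N,t)_* P_N ‖ ψ_N)/(N+1)
  → 0` and exponential concentration of the probability reference `ψ_N` give `TendstoHydroFieldsAt P Φ ρ u
  θ t` — the landed `Theorems.tendsto_measure_of_klDiv_div_tendsto_zero` (entropy inequality for events,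
  arbitrary sets) plus `P_N{z | Φ_N,t z ∈ A} ≤ ((Φ_N,t)_* P_N)(A)` (`Measure.le_map_apply`).

Composition `CappedEulerLimit_of` (REAL proof, no `sorry`): hypotheses = the three stub statements BY NAME
(`Sig.stub_*`, definitionally the signatures of the sorried stubs, so that the A12 audit sees registered
obligations only); it takes `η₀ := min ηs ηd`, `σ₀ :=` the minimum of the three profile-wise thresholds,
threads the guard to both interfaces, derives `0 < T` from `t ∈ [0,T)`, feeds probability + LLN +
time-zero identity + reference family into the capped Gronwall, and converts the entropy limit at `(t, C)`
into the crux's conclusion for the capped laws by the proved seam (the capped law `cappedLaw` unfolds to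
the crux's `(localGibbsLaw …).restrict {z | …}` definitionally). `CappedEulerLimit_skeleton` applies it to
the sorried stubs themselves.

## Disproof used
No `Cruxes/CappedEulerLimit/Disproof.lean` exists (no crux directory before this file: no
`_false_without_` theorem, no landed `Theorems/CappedEulerLimit/Negative/*`). Route-level negatives
honoured: the only refuted item of this route is the SUPPORT `ContactIntensityDomination` (stmt-9218,
refuted-misstated 2026-08-17, `Theorems.not_SpeedCapSurgery_ContactIntensityDomination`; two-rare hot-spot
witness) on the (MS) side — no stub here mentions contact intensities, marks or the (MS) crux. The target
is the PACKING-GUARDED (U) (re-typed 2026-08-16 with the conjunct, p126922): implosion / dense-excursion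
witnesses against unguarded Yau targets (0766-type) bear on no stub (every interface carries
`∀ t ∈ Ico 0 T, ∀ x, ρ t x * σ ^ 3 < η`). Sibling disproof notes honoured: `HydroLimitInBand/Disproof.lean`
§5/§6 — a Yau reference needs an activity whose one-point limit density is EXACTLY `ρ_t`: `eosActivity` is
the tree's `thermoActivity`, for which `thermoActivity_spec` proves `rhoLim = ρ` exactly; §8 tightness of
`0 < σ` — every interface keeps `0 < σ`. Typing checklist 4c: (ii) no bare Bochner integral of an
arbitrary function is asserted (the only `∫` are the crux's own field targets); (iv) thresholds are
`∃ η`, never hand-picked; `klDiv` of a SUB-probability law against a probability law is Mathlib's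
(`+ ν univ − μ univ` correction), finite and `≤ λ_N(capᶜ) + …` at `t = 0`, and for `C < 0` the cap event is
empty, the capped law is `0`, `klDiv 0 ψ = 1` and the conclusion holds trivially — no vacuity is used.

## Barriers
`HighMomentumCutoffBarrier(Narrow)` — met exactly as the route header records: the cubic current is
truncated EXACTLY on the cap event at the printed price (constant linear in the cap, Gronwall
`e^{K·cap·t}`), which at cap `C√log(N+2)` is `N^{o(1)}` and is paid by RATES inside `stub_cappedGronwall`;
`BoltzmannHypothesisBarrier(Narrow)` / `MacroErgodicityBarrier` — not evaded: the quantitative one-block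
step for the deterministic capped dynamics is contained, named, in `stub_cappedGronwall` (no ergodic claim
is smuggled into the statics stubs); `ShockFormation` — everything is per classical solution on `[0,T)`.
-/

noncomputable section

namespace Summit.AtomisticToContinuum.HydrodynamicLimit.Cruxes.CappedEulerLimit.Birth

open scoped ENNReal NNReal Topology
open MeasureTheory Filter Set InformationTheory
open Literature.Analysis.FluidPDE
open Literature.MathematicalPhysics.KineticTheory
open Summit.AtomisticToContinuum.HydrodynamicLimit.Theses.SpeedCapSurgery

/-! ## §1 Vocabulary: the cap event, the capped law, the explicit reference -/

/-- **The cap event** over the time window `[0, t]` at level `C√log(N+2)`: initial data `z` all of whose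
spheres stay slower than `C√log(N+2)` along the flow `Φ` at every time `r ∈ [0, t]` — verbatim the set the
crux restricts to. [cite: NachtergaeleYau2003, §5 Assumption II.1 and Lemma 5.1] -/
def capEvent (σ t C : ℝ) (N : ℕ)
    (Φ : HardSphereFlow (Torus.geometry (Fin 3)) (hsDiameter σ N) (N + 1)) :
    Set (Config (N + 1) (Fin 3) T3) :=
  {z | ∀ r ∈ Icc 0 t, ∀ i, ‖(Φ.flow r z i).2‖ ≤ C * Real.sqrt (Real.log ((N : ℝ) + 2))}

/-- **The capped initial law**: the local Gibbs law `localGibbsLaw σ a₀ u₀ θ₀ N Φ` RESTRICTED to the cap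
event over `[0, t]` at level `C√log(N+2)` (a sub-probability law; verbatim the crux's
`(localGibbsLaw …).restrict {z | …}`). [cite: NachtergaeleYau2003, §5] -/
def cappedLaw (σ : ℝ) (a₀ θ₀ : T3 → ℝ) (u₀ : T3 → V3) (t C : ℝ) (N : ℕ)
    (Φ : HardSphereFlow (Torus.geometry (Fin 3)) (hsDiameter σ N) (N + 1)) :
    Measure (Config (N + 1) (Fin 3) T3) :=
  (localGibbsLaw σ a₀ u₀ θ₀ N Φ).restrict (capEvent σ t C N Φ)

/-- The capped law unfolds to the crux's restricted law. [folklore] -/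
theorem cappedLaw_eq (σ : ℝ) (a₀ θ₀ : T3 → ℝ) (u₀ : T3 → V3) (t C : ℝ) (N : ℕ)
    (Φ : HardSphereFlow (Torus.geometry (Fin 3)) (hsDiameter σ N) (N + 1)) :
    cappedLaw σ a₀ θ₀ u₀ t C N Φ = (localGibbsLaw σ a₀ u₀ θ₀ N Φ).restrict
      {z | ∀ r ∈ Icc 0 t, ∀ i, ‖(Φ.flow r z i).2‖ ≤ C * Real.sqrt (Real.log ((N : ℝ) + 2))} :=
  rfl

/-- The capped law is dominated by the initial law (restriction is monotone): the logical position of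
(U) below the conjunct, `ConjunctImpliesCapped`. [folklore] -/
theorem cappedLaw_le (σ : ℝ) (a₀ θ₀ : T3 → ℝ) (u₀ : T3 → V3) (t C : ℝ) (N : ℕ)
    (Φ : HardSphereFlow (Torus.geometry (Fin 3)) (hsDiameter σ N) (N + 1)) :
    cappedLaw σ a₀ θ₀ u₀ t C N Φ ≤ localGibbsLaw σ a₀ u₀ θ₀ N Φ :=
  Measure.restrict_le_self

/-- **The thermodynamic (EOS) activity** of the hard-sphere gas at macroscopic density profile `r` and
reduced diameter `σ`: `α_σ(r)(x) = r(x) · exp(f_ex(r(x)σ³) + r(x)σ³ f_ex'(r(x)σ³))`, `f_ex = hsExcessFreeEnergy`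
(`βμ = log ρ + βμ_ex`, `βμ_ex = ∂_η(η f_ex)`). Definitionally equal to the tree's
`Theorems.KineticWindowGronwallActivityInversion.thermoActivity` and to the sibling birth lines'
`eosActivity` (same body; restated to keep this skeleton's imports to the route file and the entropy
glue). The canonical local Gibbs law is invariant under constant rescaling of the activity, so no
normalising constant is needed. [cite: Ruelle1969, §3.4] -/
def eosActivity (σ : ℝ) (r : T3 → ℝ) (x : T3) : ℝ :=
  r x * Real.exp (hsExcessFreeEnergy (r x * σ ^ 3) + r x * σ ^ 3 * deriv hsExcessFreeEnergy (r x * σ ^ 3))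

/-- **The reference concentrates.** For reduced diameter `σ`, a macroscopic triple `(r, θ', u')` on `𝕋³` and a
flow family `Φ`: the local Gibbs laws with the EOS activity `eosActivity σ r`, velocity `u'` and temperature
`θ'` are probability laws for every `N`, and their empirical density / momentum / energy fields tested against
any continuous `χ` concentrate exponentially (`≤ C e^{-(N+1)/C}`, all `N`) around `∫χ r`, `∫χ r u'`,
`∫χ E(r,u',θ')` (verbatim the sibling birth lines' `RefConcentrates`). [cite: OllaVaradhanYau1993, §3 Lemma 3.1–3.4] -/
def RefConcentrates (σ : ℝ) (r θ' : T3 → ℝ) (u' : T3 → V3)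
    (Φ : (N : ℕ) → HardSphereFlow (Torus.geometry (Fin 3)) (hsDiameter σ N) (N + 1)) : Prop :=
  (∀ N, IsProbabilityMeasure (localGibbsLaw σ (eosActivity σ r) u' θ' N (Φ N))) ∧
  ∀ χ : T3 → ℝ, Continuous χ → ∀ δ : ℝ, 0 < δ → ∃ C : ℝ, 0 < C ∧ ∀ N : ℕ,
    localGibbsLaw σ (eosActivity σ r) u' θ' N (Φ N)
        {z | δ < |empiricalDensityField z χ - ∫ x, χ x * r x|} ≤
      ENNReal.ofReal (C * Real.exp (-(C⁻¹ * (N + 1)))) ∧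
    localGibbsLaw σ (eosActivity σ r) u' θ' N (Φ N)
        {z | δ < ‖empiricalMomentumField z χ - ∫ x, (χ x * r x) • u' x‖} ≤
      ENNReal.ofReal (C * Real.exp (-(C⁻¹ * (N + 1)))) ∧
    localGibbsLaw σ (eosActivity σ r) u' θ' N (Φ N)
        {z | δ < |empiricalEnergyField z χ - ∫ x, χ x * totalEnergyDensity (r x) (u' x) (θ' x)|} ≤
      ENNReal.ofReal (C * Real.exp (-(C⁻¹ * (N + 1))))

/-! ## §2 The three interfaces -/

/-- **In-band statics of the reference family below the packing threshold `ηs`**: for all continuous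
positive profiles there is `σ₀ > 0` such that for `0 < σ < σ₀`, every classical hard-sphere Euler solution
`(ρ, u, θ)` on `[0,T)` with `ρ_t σ³ < ηs` on `[0,T) × 𝕋³` and every flow family `Φ`: (i) the initial local
Gibbs laws are probability laws; (ii) if their empirical fields converge at `t = 0` to `(ρ, ρu, E)(0)` then
at every `t ∈ [0,T)` the EOS reference `(eosActivity σ (ρ t), u t, θ t)` concentrates around `(ρ, ρu, E)(t)`
(`RefConcentrates`; mass conservation gives `∫ρ_t = 1`, the normalisation the dilute statics need).
[cite: Yau1991, §2] [cite: Ruelle1969, §3.4 and §4.2 Thm 4.2.3] -/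
def ReferenceStaticsBelow (ηs : ℝ) : Prop :=
  ∀ (a₀ θ₀ : T3 → ℝ) (u₀ : T3 → V3), Continuous a₀ → Continuous θ₀ → Continuous u₀ →
    (∀ x, 0 < a₀ x) → (∀ x, 0 < θ₀ x) →
    ∃ σ₀ : ℝ, 0 < σ₀ ∧ ∀ σ : ℝ, 0 < σ → σ < σ₀ →
      ∀ (T : ℝ) (ρ θ : ℝ → T3 → ℝ) (u : ℝ → T3 → V3), IsHardSphereEulerSolution σ T ρ u θ →
        (∀ t ∈ Ico 0 T, ∀ x, ρ t x * σ ^ 3 < ηs) →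
        ∀ Φ : (N : ℕ) → HardSphereFlow (Torus.geometry (Fin 3)) (hsDiameter σ N) (N + 1),
          (∀ N, IsProbabilityMeasure (localGibbsLaw σ a₀ u₀ θ₀ N (Φ N))) ∧
          (TendstoHydroFieldsAt (fun N => localGibbsLaw σ a₀ u₀ θ₀ N (Φ N)) Φ ρ u θ 0 →
            ∀ t ∈ Ico 0 T, RefConcentrates σ (ρ t) (θ t) (u t) Φ)

/-- **The time-zero member of the EOS reference family IS the initial law.** For all continuous positive
profiles there is `σ₀ > 0` such that for `0 < σ < σ₀`, every classical hard-sphere Euler solution on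
`[0,T)` with `0 < T` and every flow family: if the empirical fields of the initial local Gibbs laws converge
at `t = 0` to `(ρ, ρu, E)(0)`, then `localGibbsLaw σ (eosActivity σ (ρ 0)) (u 0) (θ 0) N (Φ N)` EQUALS
`localGibbsLaw σ a₀ u₀ θ₀ N (Φ N)` for every `N` (so the initial relative entropy against the reference is
`0`, with no rate lost). No packing guard is needed at `t = 0`: `ρ 0 = rhoLim a₀` is automatically dilute
for `σ < σ₀(a₀)`. Landed for the activity `ρ_0 · Rf(σ³ρ_0)`:
`Theorems/TwoClocksClampedEntropyClockTimeZeroReference.stub_timeZeroReference`. [cite: Yau1991, §2] -/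
def TimeZeroIdentity : Prop :=
  ∀ (a₀ θ₀ : T3 → ℝ) (u₀ : T3 → V3), Continuous a₀ → Continuous θ₀ → Continuous u₀ →
    (∀ x, 0 < a₀ x) → (∀ x, 0 < θ₀ x) →
    ∃ σ₀ : ℝ, 0 < σ₀ ∧ ∀ σ : ℝ, 0 < σ → σ < σ₀ →
      ∀ (T : ℝ) (ρ θ : ℝ → T3 → ℝ) (u : ℝ → T3 → V3), IsHardSphereEulerSolution σ T ρ u θ → 0 < T →
        ∀ Φ : (N : ℕ) → HardSphereFlow (Torus.geometry (Fin 3)) (hsDiameter σ N) (N + 1),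
          TendstoHydroFieldsAt (fun N => localGibbsLaw σ a₀ u₀ θ₀ N (Φ N)) Φ ρ u θ 0 →
          ∀ N : ℕ, localGibbsLaw σ (eosActivity σ (ρ 0)) (u 0) (θ 0) N (Φ N) =
            localGibbsLaw σ a₀ u₀ θ₀ N (Φ N)

/-- **Capped relative-entropy propagation below the packing threshold `ηd`** (the conclusion of Yau's
Gronwall run on the cap event, with the statics as HYPOTHESES): for all continuous positive profiles there
is `σ₀ > 0` such that for `0 < σ < σ₀`, every classical solution with `ρ_t σ³ < ηd` on `[0,T) × 𝕋³` and every
flow family: if the initial local Gibbs laws are probability laws whose fields converge at `t = 0`, the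
time-zero EOS reference IS the initial law, and the EOS reference family concentrates at every `t ∈ [0,T)`,
then for every `t ∈ [0,T)` and EVERY cap constant `C` the law at time `t` of the system started from the
CAPPED initial law `λ_N|cap_{[0,t],C}` satisfies
`H((Φ_N,t)_*(λ_N|cap) ‖ localGibbsLaw σ (eosActivity σ (ρ t)) (u t) (θ t) N Φ_N)/(N+1) → 0`. On the support of
the capped law every speed is `≤ C√log(N+2)` at every time `r ≤ t`, so the cubic energy current is
truncated exactly; the price is the Gronwall factor `exp(K·C√log(N+2)·t) = N^{o(1)}`, to be beaten by
RATES in the one-block step. [cite: Yau1991, §2 Thm] [cite: OllaVaradhanYau1993, §3 and §5 Thm 5.1]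
[cite: NachtergaeleYau2003, §5 Lemma 5.1 and §7.2] -/
def CappedEntropyPropagationBelow (ηd : ℝ) : Prop :=
  ∀ (a₀ θ₀ : T3 → ℝ) (u₀ : T3 → V3), Continuous a₀ → Continuous θ₀ → Continuous u₀ →
    (∀ x, 0 < a₀ x) → (∀ x, 0 < θ₀ x) →
    ∃ σ₀ : ℝ, 0 < σ₀ ∧ ∀ σ : ℝ, 0 < σ → σ < σ₀ →
      ∀ (T : ℝ) (ρ θ : ℝ → T3 → ℝ) (u : ℝ → T3 → V3), IsHardSphereEulerSolution σ T ρ u θ →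
        (∀ t ∈ Ico 0 T, ∀ x, ρ t x * σ ^ 3 < ηd) →
        ∀ Φ : (N : ℕ) → HardSphereFlow (Torus.geometry (Fin 3)) (hsDiameter σ N) (N + 1),
          (∀ N, IsProbabilityMeasure (localGibbsLaw σ a₀ u₀ θ₀ N (Φ N))) →
          TendstoHydroFieldsAt (fun N => localGibbsLaw σ a₀ u₀ θ₀ N (Φ N)) Φ ρ u θ 0 →
          (∀ N : ℕ, localGibbsLaw σ (eosActivity σ (ρ 0)) (u 0) (θ 0) N (Φ N) =
            localGibbsLaw σ a₀ u₀ θ₀ N (Φ N)) →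
          (∀ t ∈ Ico 0 T, RefConcentrates σ (ρ t) (θ t) (u t) Φ) →
          ∀ t ∈ Ico 0 T, ∀ C : ℝ,
            Tendsto (fun N : ℕ => klDiv ((Φ N).lawAt (cappedLaw σ a₀ θ₀ u₀ t C N (Φ N)) t)
                (localGibbsLaw σ (eosActivity σ (ρ t)) (u t) (θ t) N (Φ N)) / ((N : ℝ≥0∞) + 1))
              atTop (𝓝 0)

/-! ## §3 Stub statements by name (the hypotheses of `CappedEulerLimit_of`) -/

namespace Sig

/-- Statement of `stub_reference`. [folklore] -/
def stub_reference : Prop :=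
  ∃ ηs : ℝ, 0 < ηs ∧ ReferenceStaticsBelow ηs

/-- Statement of `stub_timeZero`. [folklore] -/
def stub_timeZero : Prop :=
  TimeZeroIdentity

/-- Statement of `stub_cappedGronwall`. [folklore] -/
def stub_cappedGronwall : Prop :=
  ∃ ηd : ℝ, 0 < ηd ∧ CappedEntropyPropagationBelow ηd

end Sig

/-! ## §4 The stubs -/

/-- **Stub 1 — IN-BAND STATICS OF THE REFERENCE FAMILY (size M).** There is a packing threshold `ηs > 0`
with `ReferenceStaticsBelow ηs`. Why plausibly true: it is the dilute STATICS of the canonical hard-sphere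
local Gibbs states plus bookkeeping — (i) `σ₀³ ≤ η ∫a₀ / sup a₀` puts the initial laws in the regime of the
proved 14445 (`uniformLocalGibbsConcentration_proof`: probability laws, hard-core domain non-empty for
every `N` once `σ < 1/2`); (ii) the classical solution conserves mass (`∫ρ_t = ∫ρ_0 = 1`, the latter from
the `t = 0` convergence with `χ ≡ 1`, `empiricalDensityField_one`), is continuous and positive, and stays
below `ηs ≤ thresh r η₂`, so `thermoActivity_spec` / `thermoActivity_concentration`
(`Theorems/AntiMazurCoboundariesKineticWindowGronwallActivityInversion`; `eosActivity` is `thermoActivity`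
by `rfl`) give `RefConcentrates` at each `t`; mass conservation along a tied classical solution is LANDED
(`Theorems/PolynomialCompression/Negative/Everywhere.integral_density_eq_one`, from
`DenseExcursionEverywhere.integral_density_eq` + `integral_density_zero_eq_one`, `σ ≤ 1/2`). Why it might
fail: only by a bookkeeping slip (thresholds: `σ₀ ≤ 1/2`, `ηs ≤ thresh r η₂` of `thermoActivity_spec`);
for `T ≤ 0` clause (ii) is vacuous. Leans on: `UniformLocalGibbsConcentration` (14445, proved),
`HsEosLowDensity` (0768, proved), `thermoActivity_spec`, `thermoActivity_concentration`,
`integral_density_eq_one`. Shared verbatim with the sibling birth lines of cruxes 17396 / 17738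
(clauses (i)–(ii) of their `ReferenceFamilyBelow`).
[cite: Ruelle1969, §3.4 and §4.2 Thm 4.2.3] [cite: Yau1991, §2] -/
theorem stub_reference : ∃ ηs : ℝ, 0 < ηs ∧ ReferenceStaticsBelow ηs := by
  sorry

/-- **Stub 2 — THE TIME-ZERO REFERENCE IS THE INITIAL LAW, EXACTLY (size M).** `TimeZeroIdentity`. Why
plausibly true: at `σ < σ₀(a₀, θ₀, u₀)` the initial laws are in the statics regime and obey their own LLN
with limit density `rhoLim (profileOf a₀) σ`; limits in probability under probability laws are unique, the
solution's slices at `t = 0` are continuous (`0 < T`), so `(ρ, u, θ)(0) = (rhoLim a₀, u₀, θ₀)` pointwise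
(`density_zero_eq_rhoLim`-type lemmas, `Theorems/TwoClocksClampedWindowDockTimeZero`); `∫ρ_0 = 1` and
`ρ_0 σ³ ≤ 2σ³ sup a₀/∫a₀ < thresh` for small `σ`, so `eosActivity σ (ρ 0) = ρ_0 · Rf(σ³ρ_0)`
(`thermoActivity_spec` (ii)) `= ζ · a₀` (`rhoLim_mul_Rf_eq`, dilute uniqueness of the activity modulo
constants), and `localGibbsLaw_const_mul` (scale invariance of the canonical law) gives equality for every
`N`. The `Rf`-form is LANDED (`stub_timeZeroReference`, Theorems/TwoClocksClampedEntropyClockTimeZeroReference).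
Why it might fail: only through the identification `eosActivity = ρ·Rf(σ³ρ)` off the band — excluded because
`ρ 0 = rhoLim a₀` is dilute for `σ < σ₀(a₀)` with no guard needed. Leans on: `stub_timeZeroReference`
(landed), `thermoActivity_spec`, `insertionFactor_package`, `localGibbsLaw_const_mul`.
[cite: Yau1991, §2] [cite: Ruelle1969, §3.4] -/
theorem stub_timeZero : TimeZeroIdentity := by
  sorry

/-- **Stub 3 — THE CAPPED DETERMINISTIC RELATIVE-ENTROPY GRONWALL IN THE BAND (size XL, load-bearing).**
There is a packing threshold `ηd > 0` with `CappedEntropyPropagationBelow ηd`. Why plausibly true: it is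
Yau 1991 / Olla–Varadhan–Yau 1993 §3 and §5 (Thm 5.1) run for the law `(Φ_N,r)_*(λ_N|cap)`, `r ∈ [0,t]`
(a fixed measurable set of initial data restricted away, so the Liouville transport and the entropy
production identity are unchanged), against the EOS reference: `d/dr H_N(r) = ` (linear terms, cancelled
by the Euler equations with `p = hsPressure`) + (one-block terms) + (bad blocks `{d̄ ≥ φ₀}`, quadratic
fluctuations: priced by the large deviations of the concentrating reference through the entropy
inequality, admissible because the guard `ρ_r σ³ < ηd` keeps the REFERENCE dilute) + (large velocities:
NONE beyond the cap — on the support of the capped law every `|v_i(r)| ≤ M_N := C√log(N+2)`, so the cubic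
energy current is truncated exactly and Nachtergaele–Yau's §5 Lemma 5.1 bound `W_{M,α} ≤ C·M·[H_α + N_α]`
applies with `M = M_N`); the entropy inequality is used with `γ_N = δ/M_N`, whence
`H' ≤ K M_N (H + N ω_N(r))` and `H_N(t) ≤ e^{K M_N t}[H_N(0) + K M_N t N sup ω_N]` (NY §7.2 with the
Chebyshev term replaced by ZERO) with `e^{K M_N t} = N^{o(1)}`; `H_N(0) = H(λ_N|cap ‖ λ_N) = λ_N(capᶜ)·0 +
(1 − λ_N(cap)) ≤ 1` by the time-zero identity (Mathlib's `klDiv` for a sub-probability law); hence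
`H_N(t)/N → 0` as soon as the one-block error has a RATE `ω_N ≤ N^{-a}` — the research content: a
QUANTITATIVE one-block / local-equilibrium estimate for the deterministic capped dynamics (bounded
velocities at every finite `N`: the flow on the cap event is the flow of an OVY-class kinetic energy,
`OVYSurrogateExists` + the card's pathwise identity, so bounded-velocity techniques apply verbatim at cap
`M_N`). For `C ≤ 0` or small `C` the capped law has vanishing mass and the conclusion is trivial
(`klDiv ≤ 1 + o(N)`). Why it might fail: (a) the one-block step for the DETERMINISTIC dynamics is the
Boltzmann-hypothesis-class content of the conjunct and no rate is in print even with noise (OVY 1993 get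
local ergodicity from the noise, rate-free, through limit states — which give NO rate); (b) the
entropy-production identity for the torus Liouville flow with hard-core CONTACT currents (jump of `log ψ_r`
at collisions = collisional transfer) has never been written; (c) any hidden constant `e^{cM²}` (e.g. from a
large-deviation bound of the capped current, OVY 1993 §3 Lemmas 3.7–3.8) would turn `N^{o(1)}` into `N^{c'}`
and force rates `a > c'` (route header, CHEAPEST FALSIFIER). Leans on: `cappedLaw`, `RefConcentrates`,
`TimeZeroIdentity` (hypotheses), `IsHardSphereEulerSolution`, `hsPressure` / `HsEosLowDensity` (0768),
`OVYSurrogateExists` (route support 9631), `Literature.Probability.Divergences` (entropy inequality),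
Mathlib `InformationTheory.klDiv`, `HardSphereFlow.lawAt`; foreseen children (route file, Two-layer plan):
`CappedGronwall ⇐ QuantitativeOneBlock` (shared territory with KnudsenRate / FluxGibbsianityLdDrude).
[cite: Yau1991, §2–3] [cite: OllaVaradhanYau1993, §3 Lemma 3.1–3.4 and §5 Thm 5.1]
[cite: NachtergaeleYau2003, §5 Lemma 5.1 and §7.2] [cite: KipnisLandim1999, Ch. 6] -/
theorem stub_cappedGronwall : ∃ ηd : ℝ, 0 < ηd ∧ CappedEntropyPropagationBelow ηd := by
  sorry

/-! ## §5 The proved seam: the entropy inequality for the capped laws -/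

/-- **Convergence in probability at time `t` from `o(N)` relative entropy of the pushed-forward law of an
ARBITRARY finite initial family `P_N` w.r.t. a concentrating local Gibbs reference** (the entropy-inequality
step of Yau's method, hard-sphere setting, initial laws not necessarily the local Gibbs laws — here the
CAPPED laws): if the reference laws `ψ_N = localGibbsLaw σ a (u t) (θ t) N Φ_N` are finite and their
empirical fields concentrate exponentially around `(ρ, ρu, E)(t)`, and `KL((Φ_N,t)_* P_N ‖ ψ_N)/(N+1) → 0`,
then the empirical fields of `Φ_N.flow t z`, `z ∼ P_N`, converge in probability (in the sense of
`TendstoHydroFieldsAt P`) to `(ρ, ρu, E)(t)`. Proof: the landed sequence form of the entropy inequality for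
events `Theorems.tendsto_measure_of_klDiv_div_tendsto_zero` (arbitrary sets), and
`P_N{z | Φ_N,t z ∈ A} ≤ ((Φ_N,t)_* P_N)(A)` (`Measure.le_map_apply`, `HardSphereFlow.measurable_flow`).
[cite: Yau1991, §2] [cite: KipnisLandim1999, Ch. 6 §1] -/
theorem tendstoHydroFieldsAt_of_klDiv_lawAt {σ : ℝ} {a : T3 → ℝ}
    {ρ θ : ℝ → T3 → ℝ} {u : ℝ → T3 → V3} {t : ℝ}
    (Φ : (N : ℕ) → HardSphereFlow (Torus.geometry (Fin 3)) (hsDiameter σ N) (N + 1))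
    (P : (N : ℕ) → Measure (Config (N + 1) (Fin 3) T3))
    [hP : ∀ N, IsFiniteMeasure (P N)]
    [hfin : ∀ N, IsFiniteMeasure (localGibbsLaw σ a (u t) (θ t) N (Φ N))]
    (hconc : ∀ χ : T3 → ℝ, Continuous χ → ∀ δ : ℝ, 0 < δ → ∃ C : ℝ, 0 < C ∧ ∀ N : ℕ,
      localGibbsLaw σ a (u t) (θ t) N (Φ N)
          {z | δ < |empiricalDensityField z χ - ∫ x, χ x * ρ t x|} ≤
        ENNReal.ofReal (C * Real.exp (-(C⁻¹ * (N + 1)))) ∧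
      localGibbsLaw σ a (u t) (θ t) N (Φ N)
          {z | δ < ‖empiricalMomentumField z χ - ∫ x, (χ x * ρ t x) • u t x‖} ≤
        ENNReal.ofReal (C * Real.exp (-(C⁻¹ * (N + 1)))) ∧
      localGibbsLaw σ a (u t) (θ t) N (Φ N)
          {z | δ < |empiricalEnergyField z χ -
            ∫ x, χ x * totalEnergyDensity (ρ t x) (u t x) (θ t x)|} ≤
        ENNReal.ofReal (C * Real.exp (-(C⁻¹ * (N + 1)))))
    (hkl : Tendsto (fun N : ℕ => klDiv ((Φ N).lawAt (P N) t)
      (localGibbsLaw σ a (u t) (θ t) N (Φ N)) / ((N : ℝ≥0∞) + 1)) atTop (𝓝 0)) :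
    TendstoHydroFieldsAt P Φ ρ u θ t := by
  intro χ hχ δ hδ
  obtain ⟨C, hC, hN⟩ := hconc χ hχ δ hδ
  -- the laws at time `t` and the transfer inequality along the flow
  set μ : ∀ N : ℕ, Measure (Config (N + 1) (Fin 3) T3) := fun N => (Φ N).lawAt (P N) t with hμ
  have hμfin : ∀ N, IsFiniteMeasure (μ N) := fun N => by
    simp only [hμ, HardSphereFlow.lawAt_eq]
    infer_instance
  have htransfer : ∀ (N : ℕ) (A : Set (Config (N + 1) (Fin 3) T3)),
      P N {z | (Φ N).flow t z ∈ A} ≤ μ N A := fun N A => by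
    simp only [hμ, HardSphereFlow.lawAt_eq]
    exact Measure.le_map_apply ((Φ N).measurable_flow t).aemeasurable A
  have key : ∀ A : ∀ N : ℕ, Set (Config (N + 1) (Fin 3) T3),
      (∀ N : ℕ, localGibbsLaw σ a (u t) (θ t) N (Φ N) (A N) ≤
        ENNReal.ofReal (C * Real.exp (-(C⁻¹ * ((N : ℝ) + 1))))) →
      Tendsto (fun N : ℕ => P N {z | (Φ N).flow t z ∈ A N}) atTop (𝓝 0) := fun A hA => by
    have h := Summit.AtomisticToContinuum.HydrodynamicLimit.Theorems.tendsto_measure_of_klDiv_div_tendsto_zero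
      μ (fun N => localGibbsLaw σ a (u t) (θ t) N (Φ N)) A hC hA hkl
    exact tendsto_of_tendsto_of_tendsto_of_le_of_le tendsto_const_nhds h
      (fun N => zero_le) (fun N => htransfer N (A N))
  refine ⟨?_, ?_, ?_⟩
  · exact key (fun N => {z | δ < |empiricalDensityField z χ - ∫ x, χ x * ρ t x|})
      (fun N => (hN N).1)
  · exact key (fun N => {z | δ < ‖empiricalMomentumField z χ - ∫ x, (χ x * ρ t x) • u t x‖})
      (fun N => (hN N).2.1)
  · exact key (fun N => {z | δ < |empiricalEnergyField z χ -
        ∫ x, χ x * totalEnergyDensity (ρ t x) (u t x) (θ t x)|}) (fun N => (hN N).2.2)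

/-! ## §6 Composition: the stubs conclude the crux BY NAME (real proof, no `sorry`) -/

/-- **The skeleton theorem.** Statics ∘ time zero ∘ capped Gronwall ∘ entropy inequality for the capped
laws: `η₀ := min ηs ηd`, `σ₀ :=` the minimum of the three profile-wise thresholds; the guard is threaded to
both interfaces, `0 < T` is read off `t ∈ [0,T)`, the capped Gronwall is fed with probability + LLN +
time-zero identity + the concentrating EOS reference family, and the entropy limit at `(t, C)` is converted
into convergence in probability of the fields under the CAPPED laws by `tendstoHydroFieldsAt_of_klDiv_lawAt`
(`cappedLaw` unfolds to the crux's restricted law definitionally). Hypotheses: the three stub statements by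
name. [folklore] -/
theorem CappedEulerLimit_of (hR : Sig.stub_reference) (hZ : Sig.stub_timeZero)
    (hG : Sig.stub_cappedGronwall) :
    Summit.AtomisticToContinuum.HydrodynamicLimit.Theses.SpeedCapSurgery.CappedEulerLimit := by
  obtain ⟨ηs, hηs, HR⟩ := hR
  obtain ⟨ηd, hηd, HG⟩ := hG
  refine ⟨min ηs ηd, lt_min hηs hηd, fun a₀ θ₀ u₀ ha hθ hu ha0 hθ0 => ?_⟩
  obtain ⟨σ₁, hσ₁, H₁⟩ := HR a₀ θ₀ u₀ ha hθ hu ha0 hθ0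
  obtain ⟨σ₂, hσ₂, H₂⟩ := hZ a₀ θ₀ u₀ ha hθ hu ha0 hθ0
  obtain ⟨σ₃, hσ₃, H₃⟩ := HG a₀ θ₀ u₀ ha hθ hu ha0 hθ0
  refine ⟨min σ₁ (min σ₂ σ₃), lt_min hσ₁ (lt_min hσ₂ hσ₃), ?_⟩
  intro σ hσ hσlt T ρ θ u hsol hguard Φ h0 t ht C
  have hσ₁' : σ < σ₁ := hσlt.trans_le (min_le_left _ _)
  have hσ₂' : σ < σ₂ := hσlt.trans_le ((min_le_right _ _).trans (min_le_left _ _))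
  have hσ₃' : σ < σ₃ := hσlt.trans_le ((min_le_right _ _).trans (min_le_right _ _))
  have hgs : ∀ s ∈ Ico 0 T, ∀ x, ρ s x * σ ^ 3 < ηs :=
    fun s hs x => (hguard s hs x).trans_le (min_le_left _ _)
  have hgd : ∀ s ∈ Ico 0 T, ∀ x, ρ s x * σ ^ 3 < ηd :=
    fun s hs x => (hguard s hs x).trans_le (min_le_right _ _)
  have hT : 0 < T := ht.1.trans_lt ht.2
  obtain ⟨hprob, href⟩ := H₁ σ hσ hσ₁' T ρ θ u hsol hgs Φ
  have hfam : ∀ s ∈ Ico 0 T, RefConcentrates σ (ρ s) (θ s) (u s) Φ := href h0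
  have hzero := H₂ σ hσ hσ₂' T ρ θ u hsol hT Φ h0
  have hkl := H₃ σ hσ hσ₃' T ρ θ u hsol hgd Φ hprob h0 hzero hfam t ht C
  obtain ⟨hψ, hconc⟩ := hfam t ht
  -- the capped laws are finite (restrictions of probability laws)
  have hfinP : ∀ N, IsFiniteMeasure (cappedLaw σ a₀ θ₀ u₀ t C N (Φ N)) := fun N => by
    unfold cappedLaw
    infer_instance
  exact tendstoHydroFieldsAt_of_klDiv_lawAt (a := eosActivity σ (ρ t)) Φ
    (fun N => cappedLaw σ a₀ θ₀ u₀ t C N (Φ N)) hconc hkl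

/-- The composition applied to the sorried stubs themselves (checks that the three `Sig.*` statements are
definitionally the stubs' signatures): closing the three stubs closes the crux. [folklore] -/
theorem CappedEulerLimit_skeleton :
    Summit.AtomisticToContinuum.HydrodynamicLimit.Theses.SpeedCapSurgery.CappedEulerLimit :=
  CappedEulerLimit_of stub_reference stub_timeZero stub_cappedGronwall

end Summit.AtomisticToContinuum.HydrodynamicLimit.Cruxes.CappedEulerLimit.Birth

end
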